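import Summits.Ventures.CertifiedArithmetic.LowPrec.SRBlockScale
import Summits.Ventures.CertifiedArithmetic.LowPrec.MXQuantize
import HarnessLib

/-!
# Block-scaled quantisation under stochastic rounding, II: scale rules (file LII)

HONEST FRAMING: certified error envelopes and provably optimal rounding/accumulation schemes for
low-precision formats under stated cost models; every table by two implementations; no hardware or
vendor claims.

File LI (`SRBlockScale`) proved, element by element, that the dequantised SR value `s·SR_φ(v/s)`
has mean `s·clamp(v/s)` (unbiased iff `|v| ≤ s·maxRat`), variance `s²·v_φ(v/s)`, and that
doubling an admissible scale never lowers a convex risk.  This file draws the BLOCK-LEVEL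
consequences for the power-of-two shared scales of the MX formats ([RouhaniEtAl2023MX, §3]):

* `mx_block_unbiased_iff` — a scale `s > 0` makes EVERY element of the block unbiased iff
  `blockMax V ≤ s·maxRat`;
* the OCP FLOOR rule `X = 2^(⌊log₂ blockMax⌋ − emax_elem)` (`MXBlock.scaleRat`):
  `mx_floor_unbiased_iff` — unbiased iff `blockMax ≤ X·maxRat`, i.e. iff the scaled block maximum
  misses the clipping window `(maxRat, 2^(emax_elem+1))` of `MXQuantize.clamp_error_lt`
  ([TsengYuPark2025, §3.1]: FP4 scaled values in `(6, 8)`); `mx_threeQuarter_unbiased` — the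
  [TsengYuPark2025, Lemma 3.1] repair (prescale by `3/4`, then SR with the floor scale) IS exactly
  unbiased for `(3/4)·V` in every format with `(3/4)·2^(emax_elem+1) ≤ maxRat` (all OCP element
  formats, `threeQuarter_hyp_formats`) — the lemma's "assume SR is implemented exactly" made a
  finite-format theorem, subnormals included;
* the CEIL rule `ceilExp = ⌈log₂ (blockMax / maxRat)⌉`, `ceilScale = 2^ceilExp` (round the shared
  exponent UP, cf. [MishraEtAl2025, Algorithm 1] for MXFP8 with RN elements):
  `mx_ceil_unbiased` — unbiased for EVERY block; `ceilExp_le_of_unbiased` — it is the LEAST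
  power-of-two scale that is (nonzero block); `ceilExp_eq_sharedExp_or_succ` /
  `ceilExp_eq_sharedExp_iff` — it equals the floor exponent exactly on the blocks where the floor
  rule is unbiased and is one binade coarser on the others;
* **`mx_ceil_optimal`** — THE CEIL SCALE IS OPTIMAL FOR EVERY CONVEX LOSS, SIMULTANEOUSLY, AMONG
  ALL UNBIASED POWER-OF-TWO SCALES: for every element `i`, every convex `h` and every `e` with
  `2^e` unbiased on the block, `E h(ceilScale·SR(Vᵢ/ceilScale)) ≤ E h(2^e·SR(Vᵢ/2^e))` — squared
  error, absolute error, higher moments, exponential moments at once (`mx_ceil_optimal_sq`).  Under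
  SR + unbiasedness there is therefore NO per-block scale-selection problem among powers of two
  (contrast round-to-nearest, where the two neighbouring scales must be compared block by block,
  and the two-candidate "4/6" selection of [CookEtAl2025], file LIII);
* `FP4Block.*` — kernel witnesses on the block `(7/2, 5/4, −1/4)` in E2M1: floor scale `1/2`
  clips `7/2` to mean `3`; ceil scale `1`: unbiased, variances `(1/4, 1/16, 1/16)`; scale `2`:
  `(1/4, 3/16, 3/16)` (strictly worse on two elements).

References: [RouhaniEtAl2023MX] §3; [TsengYuPark2025] §3.1, Lemma 3.1; [MishraEtAl2025] Alg. 1,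
App. A.1; [CookEtAl2025] §3; [PanferovEtAl2026] §3–4; [ConnollyHighamMary2021] Lemma 4.4.
-/

namespace Summit.Ventures.CertifiedArithmetic.LowPrec.SR

open Literature.ComputerArithmetic.ConnollyHighamMary2021
open Literature.ComputerArithmetic.FloatingPoint
open Literature.ComputerArithmetic.FloatingPoint.MXBlock
open Finset

section Rules

variable {φ : Format} {k : ℕ}

/-- **A BLOCK SCALE IS UNBIASED FOR THE WHOLE BLOCK IFF `blockMax ≤ s · maxRat`.** -/
theorem mx_block_unbiased_iff {s : ℚ} (hs : 0 < s) (V : Fin k → ℚ) :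
    (∀ i, scaledStep (MiniFloat.valueSet φ) s (V i) (fun y => y) = V i) ↔
      blockMax V ≤ s * φ.maxRat := by
  simp_rw [mx_unbiased_iff hs]
  constructor
  · intro h
    unfold blockMax
    exact (Finset.fold_max_le (f := fun i => |V i|) _).mpr
      ⟨mul_nonneg hs.le ((abs_nonneg _).trans (MiniFloat.abs_toRat_le_maxRat (MiniFloat.top φ))),
        fun i _ => h i⟩
  · intro h i; exact (abs_le_blockMax V i).trans h

/-! ### The OCP floor rule -/

/-- **OCP FLOOR RULE UNDER SR**: unbiased for the whole block iff `blockMax ≤ X · maxRat`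
(`X = 2^shared_exp`).  Since `blockMax / X ∈ [2^emax_elem, 2^(emax_elem+1))`
(`scaled_blockMax_mem_top_binade`), the rule is biased exactly on the blocks whose scaled maximum
falls in the clipping window `(maxRat, 2^(emax_elem+1))`. -/
theorem mx_floor_unbiased_iff (V : Fin k → ℚ) :
    (∀ i, scaledStep (MiniFloat.valueSet φ) (scaleRat φ V) (V i) (fun y => y) = V i) ↔
      blockMax V ≤ scaleRat φ V * φ.maxRat :=
  mx_block_unbiased_iff (scaleRat_pos φ V) V

/-- **[TsengYuPark2025, Lemma 3.1] EXACTLY**: prescaling by `3/4` and stochastic rounding with the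
OCP floor scale gives an unbiased estimate of `(3/4)·Vᵢ` for EVERY element of EVERY nonzero block,
in every format with `(3/4)·2^(emax_elem+1) ≤ maxRat` (the scaled block lies in
`(−2^(emax_elem+1), 2^(emax_elem+1))`, and three quarters of that is inside the hull). -/
theorem mx_threeQuarter_unbiased (h34 : 3 / 4 * (2 : ℚ) ^ (φ.emaxElem + 1) ≤ φ.maxRat)
    (V : Fin k → ℚ) (hV : 0 < blockMax V) (i : Fin k) :
    scaledStep (MiniFloat.valueSet φ) (scaleRat φ V) (3 / 4 * V i) (fun y => y) = 3 / 4 * V i := by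
  rw [mx_unbiased_iff (scaleRat_pos φ V)]
  have hX := scaleRat_pos φ V
  have hlt := scaled_lt_pow φ V hV i
  rw [div_lt_iff₀ hX] at hlt
  rw [abs_mul, abs_of_pos (by norm_num : (0 : ℚ) < 3 / 4)]
  nlinarith

/-- The `3/4` hypothesis for the OCP element formats (`6 ≤ 6`, `6 ≤ 15/2`, `24 ≤ 28`, `384 ≤ 448`,
`49152 ≤ 57344`). -/
theorem threeQuarter_hyp_formats :
    3 / 4 * (2 : ℚ) ^ (Format.E2M1.emaxElem + 1) ≤ Format.E2M1.maxRat ∧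
    3 / 4 * (2 : ℚ) ^ (Format.E2M3.emaxElem + 1) ≤ Format.E2M3.maxRat ∧
    3 / 4 * (2 : ℚ) ^ (Format.E3M2.emaxElem + 1) ≤ Format.E3M2.maxRat ∧
    3 / 4 * (2 : ℚ) ^ (Format.E4M3.emaxElem + 1) ≤ Format.E4M3.maxRat ∧
    3 / 4 * (2 : ℚ) ^ (Format.E5M2.emaxElem + 1) ≤ Format.E5M2.maxRat := by
  decide +kernel

/-! ### The ceil rule -/

/-- The CEIL exponent `⌈log₂ (blockMax / maxRat)⌉`: the least `e` with `blockMax ≤ 2^e · maxRat`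
(`Int.clog`; documented junk value `0` for the zero block). -/
def ceilExp (φ : Format) (V : Fin k → ℚ) : ℤ := Int.clog 2 (blockMax V / φ.maxRat)

/-- The ceil scale `2^ceilExp`. -/
def ceilScale (φ : Format) (V : Fin k → ℚ) : ℚ := (2 : ℚ) ^ ceilExp φ V

/-- The ceil scale is positive. -/
theorem ceilScale_pos (φ : Format) (V : Fin k → ℚ) : 0 < ceilScale φ V := zpow_pos (by norm_num) _

/-- The ceil scale does not clip the block: `blockMax ≤ ceilScale · maxRat`. -/
theorem blockMax_le_ceilScale_mul (hM : 0 < φ.maxRat) (V : Fin k → ℚ) :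
    blockMax V ≤ ceilScale φ V * φ.maxRat := by
  have h := Int.self_le_zpow_clog (R := ℚ) (b := 2) (by norm_num) (blockMax V / φ.maxRat)
  push_cast at h
  unfold ceilScale ceilExp
  rwa [div_le_iff₀ hM] at h

/-- **THE CEIL RULE IS UNBIASED FOR EVERY BLOCK** (every format with `maxRat > 0`). -/
theorem mx_ceil_unbiased (hM : 0 < φ.maxRat) (V : Fin k → ℚ) (i : Fin k) :
    scaledStep (MiniFloat.valueSet φ) (ceilScale φ V) (V i) (fun y => y) = V i :=
  (mx_block_unbiased_iff (ceilScale_pos φ V) V).mpr (blockMax_le_ceilScale_mul hM V) i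

/-- **MINIMALITY**: a power-of-two scale `2^e` that does not clip a nonzero block is at least the
ceil scale. -/
theorem ceilExp_le_of_le (hM : 0 < φ.maxRat) {V : Fin k → ℚ} (hV : 0 < blockMax V) {e : ℤ}
    (h : blockMax V ≤ (2 : ℚ) ^ e * φ.maxRat) : ceilExp φ V ≤ e := by
  have hr : 0 < blockMax V / φ.maxRat := div_pos hV hM
  have h' : blockMax V / φ.maxRat ≤ ((2 : ℕ) : ℚ) ^ e := by
    push_cast; rwa [div_le_iff₀ hM]
  exact (Int.le_zpow_iff_clog_le (by norm_num) hr).mp h'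

/-- **MINIMALITY, SR form**: every power-of-two scale that is unbiased on a nonzero block is
`≥ ceilScale`. -/
theorem ceilExp_le_of_unbiased (hM : 0 < φ.maxRat) {V : Fin k → ℚ} (hV : 0 < blockMax V) {e : ℤ}
    (h : ∀ i, scaledStep (MiniFloat.valueSet φ) ((2 : ℚ) ^ e) (V i) (fun y => y) = V i) :
    ceilExp φ V ≤ e :=
  ceilExp_le_of_le hM hV ((mx_block_unbiased_iff (zpow_pos (by norm_num) e) V).mp h)

/-- **CEIL vs FLOOR**: for a nonzero block the ceil exponent is the OCP shared exponent or one
more (format with a normal binade at the top, `1 ≤ emaxCode`). -/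
theorem ceilExp_eq_sharedExp_or_succ (hφ : 1 ≤ φ.emaxCode) {V : Fin k → ℚ} (hV : 0 < blockMax V) :
    ceilExp φ V = sharedExp φ V ∨ ceilExp φ V = sharedExp φ V + 1 := by
  have hM : 0 < φ.maxRat := lt_of_lt_of_le (zpow_pos (by norm_num) _) (Format.pow_emaxElem_le_maxRat φ hφ)
  have h2 : (2 : ℚ) ≠ 0 := by norm_num
  have hr : 0 < blockMax V / φ.maxRat := div_pos hV hM
  obtain ⟨hlo, hhi⟩ := scaled_blockMax_mem_top_binade φ V hV
  have hX := scaleRat_pos φ V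
  have hXe : scaleRat φ V = (2 : ℚ) ^ sharedExp φ V := rfl
  -- upper: blockMax / maxRat ≤ blockMax / 2^emax < 2^(sharedExp + 1)
  have hup : ceilExp φ V ≤ sharedExp φ V + 1 := by
    refine (Int.le_zpow_iff_clog_le (b := 2) (by norm_num) hr).mp ?_
    push_cast
    rw [div_le_iff₀ hM]
    rw [div_lt_iff₀ hX, hXe] at hhi
    have hp := Format.pow_emaxElem_le_maxRat φ hφ
    have e1 : (2 : ℚ) ^ (φ.emaxElem + 1) * 2 ^ sharedExp φ V
        = 2 ^ (sharedExp φ V + 1) * 2 ^ φ.emaxElem := by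
      rw [← zpow_add₀ h2, ← zpow_add₀ h2]; ring_nf
    nlinarith [zpow_pos (show (0:ℚ) < 2 by norm_num) (sharedExp φ V + 1)]
  -- lower: blockMax / maxRat > 2^sharedExp · 2^emax / 2^(emax+1) = 2^(sharedExp - 1)
  have hlo' : sharedExp φ V - 1 < ceilExp φ V := by
    refine (Int.zpow_lt_iff_lt_clog (b := 2) (by norm_num) hr).mp ?_
    push_cast
    rw [lt_div_iff₀ hM]
    rw [le_div_iff₀ hX, hXe] at hlo
    have hq := Format.maxRat_lt_pow_emaxElem φ hφ
    have e1 : (2 : ℚ) ^ φ.emaxElem * 2 ^ sharedExp φ V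
        = 2 ^ (sharedExp φ V - 1) * 2 ^ (φ.emaxElem + 1) := by
      rw [← zpow_add₀ h2, ← zpow_add₀ h2]; ring_nf
    nlinarith [zpow_pos (show (0:ℚ) < 2 by norm_num) (sharedExp φ V - 1)]
  omega

/-- **The ceil rule coincides with the floor rule exactly where the floor rule is unbiased.** -/
theorem ceilExp_eq_sharedExp_iff (hφ : 1 ≤ φ.emaxCode) {V : Fin k → ℚ} (hV : 0 < blockMax V) :
    ceilExp φ V = sharedExp φ V ↔ blockMax V ≤ scaleRat φ V * φ.maxRat := by
  have hM : 0 < φ.maxRat := lt_of_lt_of_le (zpow_pos (by norm_num) _) (Format.pow_emaxElem_le_maxRat φ hφ)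
  constructor
  · intro h
    have := blockMax_le_ceilScale_mul hM V
    unfold ceilScale at this; rwa [h] at this
  · intro h
    have h1 := ceilExp_le_of_le hM hV h
    rcases ceilExp_eq_sharedExp_or_succ hφ hV with h2 | h2 <;> omega

/-! ### Optimality of the ceil scale for every convex loss -/

/-- **THE CEIL SCALE BEATS EVERY COARSER POWER OF TWO, FOR EVERY CONVEX LOSS**: for
`ceilExp ≤ e`, every element `i` and every convex `h`,
`E h(ceilScale·SR(Vᵢ/ceilScale)) ≤ E h(2^e·SR(Vᵢ/2^e))`. -/
theorem mx_ceil_le_pow (hφ : 2 ^ (φ.manBits + 1) ≤ φ.maxScaled) (hM : 0 < φ.maxRat)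
    (V : Fin k → ℚ) {e : ℤ} (he : ceilExp φ V ≤ e) (i : Fin k) {h : ℚ → ℚ}
    (hh : ConvexOn ℚ Set.univ h) :
    scaledStep (MiniFloat.valueSet φ) (ceilScale φ V) (V i) h
      ≤ scaledStep (MiniFloat.valueSet φ) ((2 : ℚ) ^ e) (V i) h := by
  obtain ⟨n, hn⟩ : ∃ n : ℕ, e = ceilExp φ V + n := ⟨(e - ceilExp φ V).toNat, by omega⟩
  have he2 : (2 : ℚ) ^ e = 2 ^ n * ceilScale φ V := by
    rw [hn, zpow_add₀ (by norm_num : (2 : ℚ) ≠ 0), zpow_natCast]; unfold ceilScale; ring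
  rw [he2]
  exact mx_pow_le hφ (ceilScale_pos φ V)
    ((abs_le_blockMax V i).trans (blockMax_le_ceilScale_mul hM V)) hh n

/-- **THE CEIL SCALE IS OPTIMAL FOR EVERY CONVEX LOSS AMONG ALL UNBIASED POWER-OF-TWO SCALES**
(nonzero block): if `2^e` is unbiased on the block then, element by element and for every convex
`h`, the ceil scale has the smaller risk.  One scale is best for squared error, absolute error and
every other convex criterion at once. [new] -/
theorem mx_ceil_optimal (hφ : 2 ^ (φ.manBits + 1) ≤ φ.maxScaled) (hM : 0 < φ.maxRat)
    {V : Fin k → ℚ} (hV : 0 < blockMax V) {e : ℤ}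
    (hunb : ∀ i, scaledStep (MiniFloat.valueSet φ) ((2 : ℚ) ^ e) (V i) (fun y => y) = V i)
    (i : Fin k) {h : ℚ → ℚ} (hh : ConvexOn ℚ Set.univ h) :
    scaledStep (MiniFloat.valueSet φ) (ceilScale φ V) (V i) h
      ≤ scaledStep (MiniFloat.valueSet φ) ((2 : ℚ) ^ e) (V i) h :=
  mx_ceil_le_pow hφ hM V (ceilExp_le_of_unbiased hM hV hunb) i hh

/-- **Squared-error instance, summed over the block**: the ceil scale minimises the block's total
SR variance `Σᵢ E (2^e·SR(Vᵢ/2^e) − Vᵢ)²` over unbiased power-of-two scales. -/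
theorem mx_ceil_optimal_sq (hφ : 2 ^ (φ.manBits + 1) ≤ φ.maxScaled) (hM : 0 < φ.maxRat)
    {V : Fin k → ℚ} (hV : 0 < blockMax V) {e : ℤ}
    (hunb : ∀ i, scaledStep (MiniFloat.valueSet φ) ((2 : ℚ) ^ e) (V i) (fun y => y) = V i) :
    ∑ i, scaledStep (MiniFloat.valueSet φ) (ceilScale φ V) (V i) (fun y => (y - V i) ^ 2)
      ≤ ∑ i, scaledStep (MiniFloat.valueSet φ) ((2 : ℚ) ^ e) (V i) (fun y => (y - V i) ^ 2) :=
  Finset.sum_le_sum fun i _ => mx_ceil_optimal hφ hM hV hunb i (convexOn_sq_sub (V i))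

end Rules

/-! ### Kernel witnesses in FP4 (E2M1: values `±{0, 1/2, 1, 3/2, 2, 3, 4, 6}`, `maxRat = 6`) -/

namespace FP4Block

open Literature.ComputerArithmetic.FloatingPoint

/-- The witness block `V = (7/2, 5/4, −1/4)`: `blockMax = 7/2`, OCP shared exponent `−1`
(scale `1/2`, scaled maximum `7 ∈ (6, 8)`: the clipping window), ceil exponent `0` (scale `1`). -/
def V : Fin 3 → ℚ := fun i => if i = 0 then 7 / 2 else if i = 1 then 5 / 4 else -1 / 4

/-- The two rules on the witness block: floor scale `1/2`, ceil scale `1`. -/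
theorem rules_V : blockMax V = 7 / 2 ∧ sharedExp Format.E2M1 V = -1 ∧
    scaleRat Format.E2M1 V = 1 / 2 ∧ ceilExp Format.E2M1 V = 0 ∧ ceilScale Format.E2M1 V = 1 := by
  decide +kernel

/-- **FLOOR RULE CLIPS**: at scale `1/2` the element `7/2` is delivered as `3` surely (mean `3`,
bias `−1/2`, MSE `1/4`); the other two are unbiased with variances `1/16` and `0`. -/
theorem floor_V :
    scaledStep FP4.e2m1 (1 / 2) (7 / 2) (fun y => y) = 3 ∧
    scaledStep FP4.e2m1 (1 / 2) (7 / 2) (fun y => (y - 7 / 2) ^ 2) = 1 / 4 ∧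
    scaledStep FP4.e2m1 (1 / 2) (5 / 4) (fun y => y) = 5 / 4 ∧
    scaledStep FP4.e2m1 (1 / 2) (5 / 4) (fun y => (y - 5 / 4) ^ 2) = 1 / 16 ∧
    scaledStep FP4.e2m1 (1 / 2) (-1 / 4) (fun y => y) = -1 / 4 ∧
    scaledStep FP4.e2m1 (1 / 2) (-1 / 4) (fun y => (y - -1 / 4) ^ 2) = 0 := by
  decide +kernel

/-- **CEIL RULE (scale 1)**: all three elements unbiased, variances `1/4, 1/16, 1/16`; the next
power of two (scale 2): unbiased, variances `1/4, 3/16, 3/16` — never smaller, strictly larger on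
two elements (`mx_ceil_optimal` is not an equality). -/
theorem ceil_V :
    scaledStep FP4.e2m1 1 (7 / 2) (fun y => y) = 7 / 2 ∧
    scaledStep FP4.e2m1 1 (5 / 4) (fun y => y) = 5 / 4 ∧
    scaledStep FP4.e2m1 1 (-1 / 4) (fun y => y) = -1 / 4 ∧
    scaledStep FP4.e2m1 1 (7 / 2) (fun y => (y - 7 / 2) ^ 2) = 1 / 4 ∧
    scaledStep FP4.e2m1 1 (5 / 4) (fun y => (y - 5 / 4) ^ 2) = 1 / 16 ∧
    scaledStep FP4.e2m1 1 (-1 / 4) (fun y => (y - -1 / 4) ^ 2) = 1 / 16 ∧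
    scaledStep FP4.e2m1 2 (7 / 2) (fun y => (y - 7 / 2) ^ 2) = 1 / 4 ∧
    scaledStep FP4.e2m1 2 (5 / 4) (fun y => (y - 5 / 4) ^ 2) = 3 / 16 ∧
    scaledStep FP4.e2m1 2 (-1 / 4) (fun y => (y - -1 / 4) ^ 2) = 3 / 16 := by
  decide +kernel

/-- The same witnesses over the substrate `valueSet E2M1` (transport along `e2m1_eq_valueSet`):
the floor rule's clipped mean and the ceil rule's variances. -/
theorem valueSet_V :
    scaledStep (MiniFloat.valueSet Format.E2M1) (scaleRat Format.E2M1 V) (V 0) (fun y => y) = 3 ∧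
    scaledStep (MiniFloat.valueSet Format.E2M1) (ceilScale Format.E2M1 V) (V 0) (fun y => y)
      = 7 / 2 ∧
    scaledStep (MiniFloat.valueSet Format.E2M1) (ceilScale Format.E2M1 V) (V 1)
      (fun y => (y - V 1) ^ 2) = 1 / 16 ∧
    scaledStep (MiniFloat.valueSet Format.E2M1) 2 (V 1) (fun y => (y - V 1) ^ 2) = 3 / 16 := by
  have hV0 : V 0 = 7 / 2 := by decide +kernel
  have hV1 : V 1 = 5 / 4 := by decide +kernel
  rw [← e2m1_eq_valueSet, rules_V.2.2.1, rules_V.2.2.2.2, hV0, hV1]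
  exact ⟨floor_V.1, ceil_V.1, ceil_V.2.2.2.2.1, ceil_V.2.2.2.2.2.2.2.1⟩

end FP4Block

end Summit.Ventures.CertifiedArithmetic.LowPrec.SR
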